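import Literature.Probability.RandomPlanarGeometry.LoewnerAdapted
import HarnessLib

/-!
# The Loewner flow of a point of `ℍ` is a measurable functional of the driving path up to the present

Topic `Probability/RandomPlanarGeometry`. Companion of `LoewnerAdapted` (real starting points) for
starting points `z` in the **open upper half-plane**. For a family of continuous driving functions
`W ω : ℝ≥0 → ℝ` (`ω` in a measurable space `(Ω, 𝓜)`; think of `𝓜 = 𝓕ᵂ_t` and `W ω = √κ B(ω)`)
with `ω ↦ W ω s` measurable for every `s ≤ t`, and a point `z` with `0 < im z`, we prove:

* `Literature.Probability.RandomPlanarGeometry.Loewner.measurableSet_lt_swallowingTime_of_im_pos`: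
  the event `{ω | t < T_z(W ω)}` ("`z` is not yet swallowed at time `t`") is `𝓜`-measurable;
* `Literature.Probability.RandomPlanarGeometry.Loewner.measurable_map_of_im_pos`: the Loewner map
  evaluated at `z`, `ω ↦ gₜ(z)[W ω] = Loewner.map (W ω) t z` (a total function: the flow on
  `{t < T_z}`, the documented junk value `z` of `Loewner.map` elsewhere), is `𝓜`-measurable.

That is, the complex flow `zₜ = gₜ(z) - Wₜ` of Rohde–Schramm (2005), §2.1 and its lifetime
`τ(z)` are functionals of the driving path *up to the present time*, measurably — the
deterministic content of "`τ(z)` is a stopping time and `gₜ(z)` is adapted", needed for the Itô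
calculus of `zₜ` (Rohde–Schramm (2005), proofs of Thm 3.2, Lemma 6.3, Lemma 6.5).

## Method (the truncated flow, as in `LoewnerAdapted`)

For `m > 0` the **forward truncated field** `F_m(s, h) = 2 / (liftIm m h - W_s)`
(`Loewner.fwdField`; `liftIm m h = re h + i max(im h, m)` is the truncation of `LoewnerFlow.lean`)
is bounded by `2/m`, globally `2/m²`-Lipschitz in `h` and continuous in `s`, so Mathlib's
Picard–Lindelöf theorem applies on every `[0, t]` and the solution depends measurably on the
stopped driving path (`Literature.Analysis.ODE.measurable_picardSolution`). Along one path: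

* if the true flow `gₛ(z)` has `im gₛ(z) ≥ m` on `[0, t]` (which holds with `m = im gₜ(z) > 0`
  whenever `t < T_z`, the imaginary part being non-increasing and positive,
  `IsSolution.im_antitoneOn`, `IsSolution.im_pos_holds`), it solves the truncated equation, hence
  equals the truncated solution there (`truncSolC_eq_of_far`, Grönwall uniqueness);
* if a truncated solution has `im ≥ 2m` on `[0, t]`, it solves the true equation and stays
  `2m`-away from the (real) driving function, so `t < T_z` by the extension criterion
  `IsSolution.coe_lt_swallowingTime_of_le_norm_sub` (`lt_swallowingTime_of_truncSolC_far`);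

whence `{t < T_z} = ⋃ₙ ⋂_{q ∈ ℚ ∩ [0,t]} {im h^{1/(n+1)}_q ≥ 2/(n+1)}` and on it
`gₜ(z) = limₙ h^{1/(n+1)}_t` (eventually constant).

## References

* S. Rohde, O. Schramm, *Basic properties of SLE*, Ann. of Math. 161 (2005), §2.1 (the flow
  `gₜ(z)`, `τ(z)`), §3 p. 896 (measurability with respect to `σ(ξ(s), s ≤ t)`).
* G. F. Lawler, *Conformally Invariant Processes in the Plane* (2005), §4.1.
* D. Revuz, M. Yor, *Continuous Martingales and Brownian Motion* (1999), Ch. I §4, Ch. IX §1.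
* D. W. Stroock, S. R. S. Varadhan, *Multidimensional Diffusion Processes* (1979), §1.1.
-/

noncomputable section

open Set Filter MeasureTheory Metric Complex
open _root_.Topology
open scoped NNReal

namespace Literature.Probability.RandomPlanarGeometry

namespace Loewner

/-! ### The forward truncated Loewner field -/

section FwdField

variable (W : ℝ≥0 → ℝ) (m : ℝ)

/-- The **forward truncated Loewner field** `F_m(s, h) = 2 / (liftIm m h - W_s)`: the chordal
Loewner field `2/(h - W_s)` evaluated after lifting the imaginary part of `h` to at least `m`
(`liftIm`, `LoewnerFlow.lean`). It agrees with the Loewner field wherever `im h ≥ m`, and for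
`m > 0` it is bounded (`≤ 2/m`) and globally `2/m²`-Lipschitz in `h`. Time `s : ℝ` is clamped to
`ℝ≥0` as in `Loewner.vectorField`. A technical device for measurability (no claim of provenance).
[folklore] -/
def fwdField (s : ℝ) (h : ℂ) : ℂ :=
  vectorField W s (liftIm m h)

variable {W m}

/-- Unfolding of `fwdField`. [folklore] -/
theorem fwdField_apply (s : ℝ) (h : ℂ) : fwdField W m s h = 2 / (liftIm m h - W s.toNNReal) := rfl

/-- Where `im h ≥ m` the truncated field is the Loewner field. [folklore] -/
theorem fwdField_of_le {s : ℝ} {h : ℂ} (h1 : m ≤ h.im) : fwdField W m s h = vectorField W s h := by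
  rw [fwdField, liftIm_of_le h1]

/-- The truncated field is bounded by `2/m` (`m > 0`). [folklore] -/
theorem norm_fwdField_le (hm : 0 < m) (s : ℝ) (h : ℂ) : ‖fwdField W m s h‖ ≤ 2 / m := by
  rw [fwdField_apply, norm_div, RCLike.norm_ofNat]
  exact div_le_div_of_nonneg_left (by norm_num) hm
    (le_norm_sub_ofReal_of_le_im (le_im_liftIm m h) (W s.toNNReal))

/-- The truncated field is globally `2/m²`-Lipschitz in space (`m > 0`). [folklore] -/
theorem lipschitzWith_fwdField (hm : 0 < m) (s : ℝ) :
    LipschitzWith (2 / m.toNNReal ^ 2) (fwdField W m s) := by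
  have hm' : 0 < m.toNNReal := Real.toNNReal_pos.2 hm
  have hL := lipschitzOnWith_vectorField W s (δ := m.toNNReal) hm'
  have hmaps : MapsTo (liftIm m) univ {w : ℂ | ((m.toNNReal : ℝ≥0) : ℝ) ≤ ‖w - W s.toNNReal‖} :=
    fun x _ ↦ by
      rw [mem_setOf_eq, Real.coe_toNNReal _ hm.le]
      exact le_norm_sub_ofReal_of_le_im (le_im_liftIm m x) _
  have h := hL.comp (lipschitzWith_liftIm m).lipschitzOnWith hmaps
  rw [mul_one] at h
  exact lipschitzOnWith_univ.1 h

/-- The truncated field is continuous in time for each fixed `h` (continuous `W`, `m > 0`).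
[folklore] -/
theorem continuous_fwdField_left (hW : Continuous W) (hm : 0 < m) (h : ℂ) :
    Continuous fun s ↦ fwdField W m s h := by
  have hden : ∀ s : ℝ, liftIm m h - (W s.toNNReal : ℂ) ≠ 0 := fun s ↦
    norm_pos_iff.1 (hm.trans_le (le_norm_sub_ofReal_of_le_im (le_im_liftIm m h) _))
  simp only [fwdField_apply]
  exact continuous_const.div (continuous_const.sub
    (Complex.continuous_ofReal.comp (hW.comp continuous_real_toNNReal))) hden

/-- The truncated field is jointly continuous (continuous `W`, `m > 0`). [folklore] -/
theorem continuous_fwdField_uncurry (hW : Continuous W) (hm : 0 < m) :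
    Continuous (Function.uncurry (fwdField W m)) := by
  have hden : ∀ p : ℝ × ℂ, liftIm m p.2 - (W p.1.toNNReal : ℂ) ≠ 0 := fun p ↦
    norm_pos_iff.1 (hm.trans_le (le_norm_sub_ofReal_of_le_im (le_im_liftIm m p.2) _))
  have hlift : Continuous (liftIm m) := (lipschitzWith_liftIm m).continuous
  unfold Function.uncurry
  simp only [fwdField_apply]
  exact continuous_const.div ((hlift.comp continuous_snd).sub
    (Complex.continuous_ofReal.comp (hW.comp (continuous_real_toNNReal.comp continuous_fst))))
    hden

/-- **Picard–Lindelöf hypotheses for the truncated field** on `[0, T]` from any initial value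
(radius of initial data `r = 0`): Lipschitz constant `2/m²`, bound `2/m`, ball radius `2T/m + 1`.
[folklore] -/
theorem isPicardLindelof_fwdField (hW : Continuous W) (hm : 0 < m) {T : ℝ} (hT : 0 ≤ T) (x : ℂ) :
    IsPicardLindelof (fwdField W m) (⟨0, le_rfl, hT⟩ : Icc (0 : ℝ) T) x
      (2 / m * T + 1).toNNReal 0 (2 / m).toNNReal (2 / m.toNNReal ^ 2) where
  lipschitzOnWith s _ := (lipschitzWith_fwdField hm s).lipschitzOnWith
  continuousOn h _ := (continuous_fwdField_left hW hm h).continuousOn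
  norm_le s _ h _ := by
    rw [Real.coe_toNNReal _ (by positivity)]
    exact norm_fwdField_le hm s h
  mul_max_le := by
    rw [Real.coe_toNNReal _ (by positivity), Real.coe_toNNReal _ (by positivity), NNReal.coe_zero]
    have hmax : max (T - (0 : ℝ)) ((0 : ℝ) - 0) = T := by
      rw [sub_zero, sub_self, max_eq_left hT]
    calc 2 / m * max (T - (0 : ℝ)) ((0 : ℝ) - 0) = 2 / m * T := by rw [hmax]
      _ ≤ 2 / m * T + 1 - 0 := by linarith

end FwdField

/-! ### Comparison of truncated and true flows along one path -/

section Compare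

variable {W : ℝ≥0 → ℝ} {m : ℝ} {z : ℂ} {h : ℝ → ℂ} {T : ℝ≥0}

/-- A solution of the truncated equation with `im h ≥ m > 0` on `[0, T]` solves the true Loewner
equation there (`IsSolution` with lifetime `T`). [folklore] -/
theorem isSolution_of_truncSolC_far (hm : 0 < m) (h0 : h 0 = z)
    (hder : ∀ s ∈ Icc (0 : ℝ) T, HasDerivWithinAt h (fwdField W m s (h s)) (Icc (0 : ℝ) T) s)
    (hfar : ∀ s ∈ Icc (0 : ℝ) T, m ≤ (h s).im) : IsSolution W z h T := by
  refine ⟨h0, fun s hs ↦ ?_, fun s hs0 hsT heq ↦ ?_⟩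
  · obtain ⟨hs0, hsT⟩ := (mem_timeDomain_coe_iff (b := T)).1 hs
    have hsI : s ∈ Icc (0 : ℝ) T := ⟨hs0, hsT.le⟩
    have h1 := hder s hsI
    rw [fwdField_of_le (hfar s hsI)] at h1
    refine h1.mono fun u hu ↦ ?_
    obtain ⟨hu0, huT⟩ := (mem_timeDomain_coe_iff (b := T)).1 hu
    exact ⟨hu0, huT.le⟩
  · have hsT' : s < T := ((mem_timeDomain_coe_iff (b := T)).1 ⟨hs0, hsT⟩).2
    have h1 := hfar s ⟨hs0, hsT'.le⟩
    rw [heq, Complex.ofReal_im] at h1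
    exact absurd h1 (not_le.2 hm)

/-- **If a truncated solution has `im ≥ m > 0` on `[0, T]` (`T > 0`), then `z` is not swallowed
by time `T`**: `T < T_z` (the solution is `m`-away from the real driving function; extension
criterion `IsSolution.coe_lt_swallowingTime_of_le_norm_sub`). [folklore] -/
theorem lt_swallowingTime_of_truncSolC_far (hW : Continuous W) (hm : 0 < m) (hT : 0 < T)
    (h0 : h 0 = z)
    (hder : ∀ s ∈ Icc (0 : ℝ) T, HasDerivWithinAt h (fwdField W m s (h s)) (Icc (0 : ℝ) T) s)
    (hfar : ∀ s ∈ Icc (0 : ℝ) T, m ≤ (h s).im) :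
    (T : WithTop ℝ≥0) < swallowingTime W z := by
  have hsol := isSolution_of_truncSolC_far hm h0 hder hfar
  refine hsol.coe_lt_swallowingTime_of_le_norm_sub hW hT (δ := m.toNNReal)
    (Real.toNNReal_pos.2 hm) fun s hs0 hsT ↦ ?_
  rw [Real.coe_toNNReal _ hm.le]
  exact le_norm_sub_ofReal_of_le_im (hfar s ⟨hs0, hsT.le⟩) _

/-- Under the hypotheses of `lt_swallowingTime_of_truncSolC_far`, the Loewner map on `[0, T)` is
the truncated solution: `map W s z = h s` for `s < T`. [folklore] -/
theorem map_eq_of_truncSolC_far (hW : Continuous W) (hm : 0 < m) (h0 : h 0 = z)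
    (hder : ∀ s ∈ Icc (0 : ℝ) T, HasDerivWithinAt h (fwdField W m s (h s)) (Icc (0 : ℝ) T) s)
    (hfar : ∀ s ∈ Icc (0 : ℝ) T, m ≤ (h s).im) {s : ℝ≥0} (hs : s < T) :
    map W s z = h s :=
  map_eq_of_isSolution hW (isSolution_of_truncSolC_far hm h0 hder hfar) (by exact_mod_cast hs)

/-- **If the true flow has `im ≥ m` on `[0, T]`, it is the truncated solution there**: for a
solution `g` from `z` alive through `T` with `im g_s ≥ m` on `[0, T]`, and any solution `h` of
the truncated equation from `z` on `[0, T]`, `h = g` on `[0, T]` (both solve the truncated,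
globally Lipschitz, equation: Grönwall uniqueness, Mathlib `ODE_solution_unique_of_mem_Icc_right`).
[folklore] -/
theorem truncSolC_eq_of_far (hm : 0 < m) {g : ℝ → ℂ} {Tg : WithTop ℝ≥0}
    (hg : IsSolution W z g Tg) (hTg : (T : WithTop ℝ≥0) < Tg)
    (hgfar : ∀ s ∈ Icc (0 : ℝ) T, m ≤ (g s).im) (h0 : h 0 = z)
    (hder : ∀ s ∈ Icc (0 : ℝ) T, HasDerivWithinAt h (fwdField W m s (h s)) (Icc (0 : ℝ) T) s) :
    EqOn h g (Icc (0 : ℝ) T) := by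
  have hTg' : (((T : ℝ).toNNReal : ℝ≥0) : WithTop ℝ≥0) < Tg := by simpa using hTg
  have hsub := Icc_subset_timeDomain hTg'
  -- `g` solves the truncated equation on `[0, T]`
  have hgder : ∀ s ∈ Ico (0 : ℝ) T, HasDerivWithinAt g (fwdField W m s (g s)) (Ici s) s := by
    intro s hs
    rw [fwdField_of_le (hgfar s (Ico_subset_Icc_self hs))]
    exact hg.hasDerivWithinAt_Ici hsub s hs
  have hhder : ∀ s ∈ Ico (0 : ℝ) T, HasDerivWithinAt h (fwdField W m s (h s)) (Ici s) s :=
    fun s hs ↦ (hder s (Ico_subset_Icc_self hs)).mono_of_mem_nhdsWithin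
      (mem_of_superset (Icc_mem_nhdsGE hs.2) (Icc_subset_Icc hs.1 le_rfl))
  have hhcont : ContinuousOn h (Icc (0 : ℝ) T) := fun s hs ↦ (hder s hs).continuousWithinAt
  have hgcont : ContinuousOn g (Icc (0 : ℝ) T) := hg.continuousOn.mono hsub
  refine ODE_solution_unique_of_mem_Icc_right (v := fwdField W m) (s := fun _ ↦ univ)
    (K := 2 / m.toNNReal ^ 2) (fun s _ ↦ (lipschitzWith_fwdField hm s).lipschitzOnWith)
    hhcont hhder (fun _ _ ↦ mem_univ _) hgcont hgder (fun _ _ ↦ mem_univ _) ?_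
  rw [h0, hg.apply_zero]

/-- Along one solution from a point of `ℍ` alive through `t`: `im g_s ≥ im g_t > 0` on `[0, t]`
(the imaginary part is non-increasing, `IsSolution.im_antitoneOn`, and positive,
`IsSolution.im_pos_holds`). [folklore] -/
theorem im_apply_le_im_of_le (hW : Continuous W) {g : ℝ → ℂ} {Tg : WithTop ℝ≥0}
    (hg : IsSolution W z g Tg) (hz : 0 < z.im) {t : ℝ≥0} (ht : (t : WithTop ℝ≥0) < Tg) :
    0 < (g t).im ∧ ∀ s ∈ Icc (0 : ℝ) t, (g t).im ≤ (g s).im := by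
  have ht' : (((t : ℝ).toNNReal : ℝ≥0) : WithTop ℝ≥0) < Tg := by simpa using ht
  have hsub := Icc_subset_timeDomain ht'
  refine ⟨IsSolution.im_pos_holds hW hg hz t t.coe_nonneg ht', fun s hs ↦ ?_⟩
  exact hg.im_antitoneOn hW hz (hsub hs) (hsub ⟨t.coe_nonneg, le_rfl⟩) hs.2

end Compare

/-! ### A measurable family of driving paths: the truncated flow is measurable -/

section Parametrised

variable {Ω : Type*} {mΩ : MeasurableSpace Ω} {W : Ω → ℝ≥0 → ℝ} {t : ℝ≥0}

/-- The truncated fields of the stopped paths are jointly measurable in `(ω, time, space)`.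
[folklore] -/
theorem measurable_fwdField_stoppedPath (hc : ∀ ω, Continuous (W ω))
    (hmeas : ∀ s, s ≤ t → Measurable fun ω ↦ W ω s) (m : ℝ) :
    Measurable fun p : Ω × ℝ × ℂ ↦ fwdField (stoppedPath W t p.1) m p.2.1 p.2.2 := by
  have h1 : Measurable fun p : Ω × ℝ × ℂ ↦ stoppedPath W t p.1 p.2.1.toNNReal :=
    (measurable_stoppedPath_uncurry hc hmeas).comp (measurable_fst.prodMk (measurable_snd.fst))
  have hlift : Measurable (liftIm m) := (lipschitzWith_liftIm m).continuous.measurable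
  simp only [fwdField_apply]
  exact measurable_const.div ((hlift.comp measurable_snd.snd).sub
    (Complex.measurable_ofReal.comp h1))

/-- The Picard–Lindelöf hypotheses for the truncated fields of the stopped paths, uniformly in
`ω` (`isPicardLindelof_fwdField`). [folklore] -/
theorem isPicardLindelof_fwdField_stoppedPath (hc : ∀ ω, Continuous (W ω)) {m : ℝ} (hm : 0 < m)
    (x : ℂ) (ω : Ω) :
    IsPicardLindelof (fwdField (stoppedPath W t ω) m) (⟨0, le_rfl, t.coe_nonneg⟩ : Icc (0 : ℝ) t)
      x (2 / m * t + 1).toNNReal 0 (2 / m).toNNReal (2 / m.toNNReal ^ 2) :=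
  isPicardLindelof_fwdField (continuous_stoppedPath (hc ω)) hm t.coe_nonneg x

variable (t) in
/-- **The truncated complex flow** `h^m : Ω → ℝ → ℂ`: for each `ω`, the solution on `[0, t]` of
`ḣ = 2/(liftIm m h - W ω)`, `h(0) = x` (driving path stopped at `t`), chosen by the Picard scheme
(`Literature.Analysis.ODE.picardSolution`), hence measurable in `ω` at each time
(`measurable_truncFlowC`). [folklore] -/
def truncFlowC (hc : ∀ ω, Continuous (W ω)) {m : ℝ} (hm : 0 < m) (x : ℂ) : Ω → ℝ → ℂ :=
  Literature.Analysis.ODE.picardSolution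
    (isPicardLindelof_fwdField_stoppedPath (W := W) (t := t) hc hm x) (mem_closedBall_self le_rfl)

/-- The truncated flow starts at `x`. [folklore] -/
theorem truncFlowC_zero (hc : ∀ ω, Continuous (W ω)) {m : ℝ} (hm : 0 < m) (x : ℂ) (ω : Ω) :
    truncFlowC t hc hm x ω 0 = x :=
  (Literature.Analysis.ODE.picardSolution_spec
    (isPicardLindelof_fwdField_stoppedPath (W := W) (t := t) hc hm x)
    (mem_closedBall_self le_rfl) ω).1

/-- The truncated flow solves the truncated Loewner equation of the (unstopped) path on `[0, t]`.
[folklore] -/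
theorem hasDerivWithinAt_truncFlowC (hc : ∀ ω, Continuous (W ω)) {m : ℝ} (hm : 0 < m) (x : ℂ)
    (ω : Ω) {s : ℝ} (hs : s ∈ Icc (0 : ℝ) t) :
    HasDerivWithinAt (truncFlowC t hc hm x ω)
      (fwdField (W ω) m s (truncFlowC t hc hm x ω s)) (Icc (0 : ℝ) t) s := by
  have h := (Literature.Analysis.ODE.picardSolution_spec
    (isPicardLindelof_fwdField_stoppedPath (W := W) (t := t) hc hm x)
    (mem_closedBall_self le_rfl) ω).2 s hs
  refine h.congr_deriv ?_
  simp only [truncFlowC, fwdField_apply]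
  rw [stoppedPath_of_le ((Real.toNNReal_le_iff_le_coe).2 hs.2)]

/-- The truncated flow is continuous in time. [folklore] -/
theorem continuous_truncFlowC (hc : ∀ ω, Continuous (W ω)) {m : ℝ} (hm : 0 < m) (x : ℂ)
    (ω : Ω) : Continuous (truncFlowC t hc hm x ω) :=
  Literature.Analysis.ODE.continuous_picardSolution _ _ ω

/-- **The truncated flow is measurable in `ω`** at each time, when the path values at times `≤ t`
are measurable (`Literature.Analysis.ODE.measurable_picardSolution`). [folklore] -/
theorem measurable_truncFlowC (hc : ∀ ω, Continuous (W ω))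
    (hmeas : ∀ s, s ≤ t → Measurable fun ω ↦ W ω s) {m : ℝ} (hm : 0 < m) (x : ℂ) (s : ℝ) :
    Measurable fun ω ↦ truncFlowC t hc hm x ω s :=
  Literature.Analysis.ODE.measurable_picardSolution _ _
    (measurable_fwdField_stoppedPath hc hmeas m) s

/-! ### `{t < T_z}` is measurable and the flow is measurable on it -/

/-- **Key identification along one path** (`t < T_z(W ω)`): if the true flow has `im ≥ M` on
`[0, t]` and `1/(n+1) ≤ M`, then the truncated flow at level `1/(n+1)` is the true flow on
`[0, t]`. [folklore] -/
theorem truncFlowC_eq (hc : ∀ ω, Continuous (W ω)) {x : ℂ} (ω : Ω) {g : ℝ → ℂ}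
    (hg : IsSolution (W ω) x g (swallowingTime (W ω) x))
    (ht : (t : WithTop ℝ≥0) < swallowingTime (W ω) x) {M : ℝ} (n : ℕ) (hnM : 1 / (n + 1 : ℝ) ≤ M)
    (hgfar : ∀ s ∈ Icc (0 : ℝ) t, M ≤ (g s).im) :
    EqOn (truncFlowC t hc (one_div_succ_pos n) x ω) g (Icc (0 : ℝ) t) :=
  truncSolC_eq_of_far (one_div_succ_pos n) hg ht (fun s hs ↦ hnM.trans (hgfar s hs))
    (truncFlowC_zero hc _ x ω) fun _ hs ↦ hasDerivWithinAt_truncFlowC hc _ x ω hs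

variable (W t) in
/-- The measurable description of `{t < T_z}`: the `n`-th approximating event "the truncated flow
at level `1/(n+1)` has imaginary part `≥ 2/(n+1)` at all rational times of `[0, t]`". [folklore] -/
def farEventC (hc : ∀ ω, Continuous (W ω)) (x : ℂ) (n : ℕ) : Set Ω :=
  ⋂ q : ℚ, {ω | (q : ℝ) ∈ Icc (0 : ℝ) t →
    2 * (1 / (n + 1 : ℝ)) ≤ (truncFlowC t hc (one_div_succ_pos n) x ω q).im}

/-- The approximating events are measurable (countable intersections of measurable events).
[folklore] -/
theorem measurableSet_farEventC (hc : ∀ ω, Continuous (W ω))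
    (hmeas : ∀ s, s ≤ t → Measurable fun ω ↦ W ω s) (x : ℂ) (n : ℕ) :
    MeasurableSet (farEventC W t hc x n) := by
  refine MeasurableSet.iInter fun q ↦ ?_
  by_cases hq : (q : ℝ) ∈ Icc (0 : ℝ) t
  · have hm : Measurable fun ω ↦ (truncFlowC t hc (one_div_succ_pos n) x ω q).im :=
      Complex.measurable_im.comp (measurable_truncFlowC hc hmeas _ x _)
    have : {ω | (q : ℝ) ∈ Icc (0 : ℝ) t →
        2 * (1 / (n + 1 : ℝ)) ≤ (truncFlowC t hc (one_div_succ_pos n) x ω q).im} =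
        {ω | 2 * (1 / (n + 1 : ℝ)) ≤ (truncFlowC t hc (one_div_succ_pos n) x ω q).im} := by
      ext ω; simp [hq]
    rw [this]
    exact measurableSet_le measurable_const hm
  · have : {ω | (q : ℝ) ∈ Icc (0 : ℝ) t →
        2 * (1 / (n + 1 : ℝ)) ≤ (truncFlowC t hc (one_div_succ_pos n) x ω q).im} = univ := by
      ext ω; simp only [mem_setOf_eq, mem_univ, iff_true]; exact fun h ↦ absurd h hq
    rw [this]
    exact MeasurableSet.univ

/-- **`{t < T_z} = ⋃ₙ farEventC n`** for `im z > 0` and `t > 0`: (⊆) the true flow has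
`im ≥ im gₜ(z) > 0` on `[0, t]`, and for `2/(n+1) ≤ im gₜ(z)` the truncated flow equals it; (⊇) by
continuity the truncated flow has `im ≥ 2/(n+1)` at *all* times of `[0, t]`, hence solves the
true equation and `t < T_z` (`lt_swallowingTime_of_truncSolC_far`). [folklore] -/
theorem setOf_lt_swallowingTime_eq_iUnion_of_im_pos (hc : ∀ ω, Continuous (W ω))
    {x : ℂ} (hx : 0 < x.im) (ht : 0 < t) :
    {ω | (t : WithTop ℝ≥0) < swallowingTime (W ω) x} = ⋃ n, farEventC W t hc x n := by
  ext ω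
  simp only [mem_setOf_eq, mem_iUnion]
  have hx0 : x ≠ W ω 0 := by
    intro h
    rw [h, Complex.ofReal_im] at hx
    exact lt_irrefl _ hx
  constructor
  · intro hlt
    obtain ⟨g, hg⟩ := exists_isSolution_swallowingTime_holds (hc ω) hx0
    obtain ⟨hpos, hfar⟩ := im_apply_le_im_of_le (hc ω) hg hx hlt
    obtain ⟨n, hn⟩ := exists_nat_one_div_lt (half_pos hpos)
    refine ⟨n, mem_iInter.2 fun q hq ↦ ?_⟩
    have hnM : 1 / (n + 1 : ℝ) ≤ (g t).im := by linarith
    rw [truncFlowC_eq hc ω hg hlt n hnM hfar hq]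
    linarith [hfar q hq]
  · rintro ⟨n, hn⟩
    have hn' := mem_iInter.1 hn
    have hcontF : Continuous fun s ↦ (truncFlowC t hc (one_div_succ_pos n) x ω s).im :=
      Complex.continuous_im.comp (continuous_truncFlowC hc _ x ω)
    have hall := forall_Icc_le_of_forall_rat hcontF t.coe_nonneg fun q hq ↦ hn' q hq
    have h2 : ∀ s ∈ Icc (0 : ℝ) t, 1 / (n + 1 : ℝ) ≤ (truncFlowC t hc (one_div_succ_pos n) x ω s).im :=
      fun s hs ↦ by linarith [hall s hs, one_div_succ_pos n]
    exact lt_swallowingTime_of_truncSolC_far (hc ω) (one_div_succ_pos n) ht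
      (truncFlowC_zero hc _ x ω) (fun s hs ↦ hasDerivWithinAt_truncFlowC hc _ x ω hs) h2

/-- **The event `{t < T_z}` is measurable** with respect to any σ-algebra for which the driving
path values at times `≤ t` are measurable (continuous paths, `im z > 0`): "`z` is not yet
swallowed" is decided by the path up to time `t`, measurably. Rohde–Schramm (2005), §2.1, §3;
Revuz–Yor (1999), Ch. I §4. [cite: RohdeSchramm2005, §2.1] -/
theorem measurableSet_lt_swallowingTime_of_im_pos (hc : ∀ ω, Continuous (W ω))
    (hmeas : ∀ s, s ≤ t → Measurable fun ω ↦ W ω s) {x : ℂ} (hx : 0 < x.im) :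
    MeasurableSet {ω | (t : WithTop ℝ≥0) < swallowingTime (W ω) x} := by
  rcases (zero_le : (0 : ℝ≥0) ≤ t).eq_or_lt with ht | ht
  · have : {ω | (t : WithTop ℝ≥0) < swallowingTime (W ω) x} = univ := by
      refine eq_univ_of_forall fun ω ↦ ?_
      rw [mem_setOf_eq, ← ht]
      refine swallowingTime_pos_holds (hc ω) fun h ↦ ?_
      rw [h, Complex.ofReal_im] at hx
      exact lt_irrefl _ hx
    rw [this]
    exact MeasurableSet.univ
  · rw [setOf_lt_swallowingTime_eq_iUnion_of_im_pos hc hx ht]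
    exact MeasurableSet.iUnion fun n ↦ measurableSet_farEventC hc hmeas x n

/-- After the swallowing time the Loewner map takes its documented junk value: if `¬ t < T_z`
then `map W t z = z` (no solution from `z` lives beyond `t`). [folklore] -/
theorem map_of_not_lt_swallowingTime {V : ℝ≥0 → ℝ} {x : ℂ} {s : ℝ≥0}
    (h : ¬ (s : WithTop ℝ≥0) < swallowingTime V x) : map V s x = x := by
  classical
  have hne : ¬ ∃ p : (ℝ → ℂ) × WithTop ℝ≥0, IsSolution V x p.1 p.2 ∧ (s : WithTop ℝ≥0) < p.2 :=
    fun ⟨p, hp, hsp⟩ ↦ h (hsp.trans_le hp.le_swallowingTime)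
  rw [map, dif_neg hne]

/-- **The Loewner flow of a point of `ℍ` is a measurable functional of the path up to the
present**: `ω ↦ gₜ(z)[W ω] = map (W ω) t z` (the flow on `{t < T_z}`, the junk value `z`
elsewhere) is measurable with respect to any σ-algebra making the path values at times `≤ t`
measurable (continuous paths, `im z > 0`). On `{t < T_z}` it is the (eventually stationary) limit
of the measurable truncated flows. Rohde–Schramm (2005), §2.1 and §3 (p. 896).
[cite: RohdeSchramm2005, §2.1] -/
theorem measurable_map_of_im_pos (hc : ∀ ω, Continuous (W ω))
    (hmeas : ∀ s, s ≤ t → Measurable fun ω ↦ W ω s) {x : ℂ} (hx : 0 < x.im) :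
    Measurable fun ω ↦ map (W ω) t x := by
  classical
  set E := {ω | (t : WithTop ℝ≥0) < swallowingTime (W ω) x} with hE
  have hEm : MeasurableSet E := measurableSet_lt_swallowingTime_of_im_pos hc hmeas hx
  set G : ℕ → Ω → ℂ := fun n ω ↦ if ω ∈ E then
    truncFlowC t hc (one_div_succ_pos n) x ω t else x with hG
  have hGm : ∀ n, Measurable (G n) := fun n ↦
    Measurable.ite hEm (measurable_truncFlowC hc hmeas _ x _) measurable_const
  refine measurable_of_tendsto_metrizable hGm (tendsto_pi_nhds.2 fun ω ↦ ?_)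
  by_cases hω : ω ∈ E
  · have hlt : (t : WithTop ℝ≥0) < swallowingTime (W ω) x := hω
    simp only [hG, if_pos hω]
    have hx0 : x ≠ W ω 0 := by
      intro h
      rw [h, Complex.ofReal_im] at hx
      exact lt_irrefl _ hx
    obtain ⟨g, hg⟩ := exists_isSolution_swallowingTime_holds (hc ω) hx0
    obtain ⟨hpos, hfar⟩ := im_apply_le_im_of_le (hc ω) hg hx hlt
    obtain ⟨n₀, hn₀⟩ := exists_nat_one_div_lt hpos
    refine tendsto_const_nhds.congr' ?_
    filter_upwards [eventually_ge_atTop n₀] with n hn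
    have hnM : 1 / (n + 1 : ℝ) ≤ (g t).im := by
      have h1 : (1 : ℝ) / (n + 1) ≤ 1 / (n₀ + 1) :=
        one_div_le_one_div_of_le (by positivity) (by exact_mod_cast Nat.succ_le_succ hn)
      linarith
    have heq := truncFlowC_eq hc ω hg hlt n hnM hfar ⟨t.coe_nonneg, le_rfl⟩
    rw [heq, map_eq_of_isSolution (hc ω) hg hlt]
  · have hlt : ¬ (t : WithTop ℝ≥0) < swallowingTime (W ω) x := hω
    simp only [hG, if_neg hω]
    rw [map_of_not_lt_swallowingTime hlt]
    exact tendsto_const_nhds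

end Parametrised

end Loewner

end Literature.Probability.RandomPlanarGeometry
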